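import Summits.CriticalPhenomena.SAWScalingLimit.Theorems.SAWRenewalTightnessTubeLowerBoundDefs
import Literature.Probability.RandomPlanarGeometry.SAWBridges
import Literature.Probability.RandomPlanarGeometry.SAWBridgeRadius

/-!
# Crux `SAWRenewalTightness.TubeLowerBound` (stmt-CriticalPhenomena-4730): objects of the line `profile-potential`

Definitions (statements only — no stub is asserted or proved here) used by the positive-side files of the
round-2 line `profile-potential` of this crux, i.e. by the registered stubs of the checked skeleton
`Summits/CriticalPhenomena/SAWScalingLimit/Cruxes/TubeLowerBound/Lines/profile_potential.lean`
(planner-cruxplan-stmt-CriticalPhenomena-4730-profile-potential-0, `ledger skeleton check` 2026-08-16; lead a1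
`prover-line-stmt-CriticalPhenomena-4730-a1-0`) and by its composition theorem `TubeLowerBound_of`.  The statements
are VERBATIM those of the skeleton (same binder names, same order), so that a stub file proves a registered
signature by name after `open`ing this namespace.

The line runs the Simon–Lieb / Hammersley first-exit cut INSIDE THE QUADRANT `Q = {x ≥ 0, y ≥ 0}` from its corner
`0`, with the closed square `[0,R]²` as inner set (near sides are walls; the two far sides are exchanged by the
diagonal reflection), and in the half-plane `{x ≥ 0}` from a wall point with the slab `[0,R] × ℤ` as inner set.

* §A quadrant objects `quadWalks`, `squareWalks`, `cornerExitEast` and statements `QuadrantCut` (S1, the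
  fugacity-free cut, length by length), `QuadrantDivergence` (S2, OPEN: the critical corner susceptibility of the
  quadrant is infinite), `QuadrantProfileBound` (S3, OPEN, hardest: the susceptibility-profile RATIO CEILING in
  partial-sum form at `x_c`), `CountProfileBound` (the admissible stronger count form of S3);
* §B half-plane objects `hpWalks`, `slabWalks`, `wallBridges` and statements `HalfPlaneCut` (S5),
  `SlabSubcritical` (classical print hypothesis of the by-product door: a slab of fixed width is subcritical at
  `x_c`), `HalfPlaneProfileBound` (OPEN) and the milestone `SpanRenewalFloor` (Kesten's span-renewal floor, vertex
  form — verbatim the conclusion of the landed `SubcriticalRenewalFloor.spanRenewalFloor_vertex_of_word`).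

All statements are over tree vocabulary (`SAW.Zd.saws`, `SAW.Zd.bridges`, `SAW.criticalFugacity`); every series is a
PARTIAL SUM (`∃ N` / `∀ N ≥ N₀`), no `HasSum`/`tsum`; every exponent carries `0 ≤ C` and every ratio constant `1 ≤ A`
(cf. the landed `Negative.constraints`, `Negative.not_allN`).  `CornerCrossingFloor` (the target of S4) is the landed
`LiebSimonStar.CornerCrossingFloor` (Defs p76932), imported, not restated.  Sources for the cut: B. Simon, Comm. Math.
Phys. 77 (1980); E. Lieb, Comm. Math. Phys. 77 (1980); N. Madras, G. Slade, *The Self-Avoiding Walk* (1993) §1.5;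
wedge exponents quoted in docstrings (plausibility only, never used): J. Cardy, Nucl. Phys. B 240 (1984);
B. Duplantier, H. Saleur, Phys. Rev. Lett. 57 (1986).
-/

noncomputable section

namespace Summit.CriticalPhenomena.SAWScalingLimit.Theorems.TubeLowerBound.ProfilePotential

open scoped BigOperators Classical
open Literature.Probability.LatticeModels
open Literature.Probability.RandomPlanarGeometry Literature.Probability.RandomPlanarGeometry.SAW

/-! ## A. Objects and statements of the quadrant variant -/

/-- `n`-step self-avoiding walks from `0` all of whose vertices lie in the shifted quadrant `{x ≥ −a, y ≥ −a}`
(`a = 0`: the corner-started quadrant walks, count `q_n`; `a = R+1`: a superset of every translated suffix of the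
cut). -/
def quadWalks (a : ℕ) (n : ℕ) : Finset (ℕ → Site 2) :=
  (Zd.saws 2 n).filter (fun ω => ∀ i ≤ n, -(a : ℤ) ≤ ω i 0 ∧ -(a : ℤ) ≤ ω i 1)

/-- Corner-started walks staying in the closed square `[0,R]²` for all `i ≤ n` (empty once `n ≥ (R+1)²`). -/
def squareWalks (R : ℕ) (n : ℕ) : Finset (ℕ → Site 2) :=
  (Zd.saws 2 n).filter (fun ω => ∀ i ≤ n, 0 ≤ ω i 0 ∧ ω i 0 ≤ (R : ℤ) ∧ 0 ≤ ω i 1 ∧ ω i 1 ≤ (R : ℤ))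

/-- East first-exit prefixes of the square: corner-started walks in `[0,R]²` for `i < n` whose `n`-th vertex is
`(R+1, y)` with `0 ≤ y ≤ R` (the last two conjuncts are automatic for `n ≥ 1` and exclude `n = 0`; they make the
inclusion into `CornerCrossingFloor`'s family at `a = R+1`, `K = 1` a plain filter inclusion). -/
def cornerExitEast (R : ℕ) (n : ℕ) : Finset (ℕ → Site 2) :=
  (Zd.saws 2 n).filter (fun ω => (∀ i < n, 0 ≤ ω i 0 ∧ ω i 0 ≤ (R : ℤ) ∧ 0 ≤ ω i 1 ∧ ω i 1 ≤ (R : ℤ)) ∧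
    ω n 0 = (R : ℤ) + 1 ∧ 0 ≤ ω n 1 ∧ ω n 1 ≤ (R : ℤ))

/-- **`QuadrantCut`** (statement of stub S1; the fugacity-free first-exit cut in the quadrant, length by length):
for all `R n`, `q_n ≤ s_n + 2 Σ_{k ≤ n} e_k q^{(R+1)}_{n−k}`.  Cut a corner walk at its first exit from `[0,R]²` (if
any): it exits through the east column `x = R+1` at a height `y ≤ R` or through the north row (the diagonal mirror
image of an east exit), the prefix is an element of `cornerExitEast R k` (or its mirror), and the suffix translated
to `0` stays in `{x ≥ −(R+1), y ≥ −(R+1)}`; `ω ↦ (k, prefix, suffix)` is injective.  (Simon–Lieb / Hammersley cut run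
inside a domain with boundary.) -/
def QuadrantCut : Prop :=
  ∀ R n : ℕ, ((quadWalks 0 n).card : ℝ) ≤ (squareWalks R n).card +
    2 * ∑ k ∈ Finset.range (n + 1), ((cornerExitEast R k).card : ℝ) * (quadWalks (R + 1) (n - k)).card

/-- **`QuadrantDivergence`** (statement of stub S2; OPEN, conjecture-grade — an exponent inequality
"`γ(π/2) ≥ 0`" for the 90° wedge; in print only the growth constant of wedge walks is known to equal `μ`): the
critical corner susceptibility of the quadrant is infinite — the partial sums `Σ_{n≤N} q_n x_c^n` are unbounded.
Qualitative (no rate); predicted `q_n x_c^n ≍ n^{−33/64}` (Cardy 1984 / Duplantier–Saleur 1986: `γ(π/2) = 31/64`). -/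
def QuadrantDivergence : Prop :=
  ∀ M : ℝ, ∃ N : ℕ, M ≤ ∑ n ∈ Finset.range (N + 1), ((quadWalks 0 n).card : ℝ) * criticalFugacity ^ n

/-- **`QuadrantProfileBound`** (statement of stub S3, in PARTIAL-SUM form at `x_c`; OPEN, conjecture-grade, the
hardest stub of the line): there are `A ≥ 1`, `C ≥ 0` such that for every `R`, for all large `N`,
`Σ_{n≤N} q^{(R+1)}_n x_c^n ≤ A (R+2)^C Σ_{n≤N} q_n x_c^n` — moving the corner diagonally away by `R+1` multiplies the
critical quadrant susceptibility (read as partial sums) by at most a polynomial in `R`.  A RATIO CEILING, not a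
floor; predicted ratio `≍ R^{55/48}`; `N₀(R)` is free. -/
def QuadrantProfileBound : Prop :=
  ∃ A C : ℝ, 1 ≤ A ∧ 0 ≤ C ∧ ∀ R : ℕ, ∃ N₀ : ℕ, ∀ N : ℕ, N₀ ≤ N →
    ∑ n ∈ Finset.range (N + 1), ((quadWalks (R + 1) n).card : ℝ) * criticalFugacity ^ n ≤
      A * ((R : ℝ) + 2) ^ C * ∑ n ∈ Finset.range (N + 1), ((quadWalks 0 n).card : ℝ) * criticalFugacity ^ n

/-- **`CountProfileBound`** (the fugacity-free count form of S3; not a registered stub — an admissible STRONGER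
replacement, `CountProfileBound ∧ QuadrantDivergence → QuadrantProfileBound`): `q^{(R+1)}_n ≤ A (R+2)^C q_n` for all
`n ≥ n₀(R)`. -/
def CountProfileBound : Prop :=
  ∃ A C : ℝ, 1 ≤ A ∧ 0 ≤ C ∧ ∀ R : ℕ, ∃ n₀ : ℕ, ∀ n : ℕ, n₀ ≤ n →
    ((quadWalks (R + 1) n).card : ℝ) ≤ A * ((R : ℝ) + 2) ^ C * (quadWalks 0 n).card

/-! ## B. Objects and statements of the half-plane variant (by-product door to `SpanRenewalFloor`) -/

/-- `n`-step self-avoiding walks from `0` with `x ≥ −t` throughout (weak half-plane walks "from depth `t`"). -/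
def hpWalks (t : ℕ) (n : ℕ) : Finset (ℕ → Site 2) :=
  (Zd.saws 2 n).filter (fun ω => ∀ i ≤ n, -(t : ℤ) ≤ ω i 0)

/-- Walks from the wall point `0` staying in the slab `0 ≤ x ≤ R` for all `i ≤ n`. -/
def slabWalks (R : ℕ) (n : ℕ) : Finset (ℕ → Site 2) :=
  (Zd.saws 2 n).filter (fun ω => ∀ i ≤ n, 0 ≤ ω i 0 ∧ ω i 0 ≤ (R : ℤ))

/-- Weak bridges of span `R+1` from the wall point: in the slab `[0,R] × ℤ` for `i < n`, `n`-th vertex on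
`x = R+1` (prepending one east step gives a bridge of `Zd.bridges 2 (n+1)` with end column `R+2`). -/
def wallBridges (R : ℕ) (n : ℕ) : Finset (ℕ → Site 2) :=
  (Zd.saws 2 n).filter (fun ω => (∀ i < n, 0 ≤ ω i 0 ∧ ω i 0 ≤ (R : ℤ)) ∧ ω n 0 = (R : ℤ) + 1)

/-- **`HalfPlaneCut`** (statement of stub S5; fugacity-free, length by length): `h̃_n ≤ sl_n + Σ_{k≤n} w_k
h̃^{(R+1)}_{n−k}` — cut a weak half-plane walk from the wall point at its first visit of the column `x = R+1`; the
prefix is a wall bridge, the suffix translated to `0` stays in `{x ≥ −(R+1)}`.  ONE exit class, no symmetry. -/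
def HalfPlaneCut : Prop :=
  ∀ R n : ℕ, ((hpWalks 0 n).card : ℝ) ≤ (slabWalks R n).card +
    ∑ k ∈ Finset.range (n + 1), ((wallBridges R k).card : ℝ) * (hpWalks (R + 1) (n - k)).card

/-- **`SlabSubcritical`** (print hypothesis of the door; Kesten's pattern theorem in its general form gives
`μ_slab < μ`, Madras–Slade (8.2.11) p. 210 and Thm 7.2.3): a slab of fixed width is subcritical at `x_c`, stated as
bounded partial sums of the slab generating function at `x_c` (source: Madras–Slade 1993, Theorem 7.2.3 and eq. (8.2.11), p. 210). -/
def SlabSubcritical : Prop :=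
  ∀ R : ℕ, ∃ S : ℝ, ∀ N : ℕ,
    ∑ n ∈ Finset.range (N + 1), ((slabWalks R n).card : ℝ) * criticalFugacity ^ n ≤ S

/-- **`HalfPlaneProfileBound`** (hypothesis of the door, in partial-sum form at `x_c`; OPEN):
`Σ_{n≤N} h̃^{(t)}_n x_c^n ≤ A (t+1)^C Σ_{n≤N} h̃_n x_c^n` for all large `N` — the near-critical half-plane
susceptibility profile grows polynomially in the distance to the wall.  Predicted `≍ t^{25/48}`. -/
def HalfPlaneProfileBound : Prop :=
  ∃ A C : ℝ, 1 ≤ A ∧ 0 ≤ C ∧ ∀ t : ℕ, ∃ N₀ : ℕ, ∀ N : ℕ, N₀ ≤ N →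
    ∑ n ∈ Finset.range (N + 1), ((hpWalks t n).card : ℝ) * criticalFugacity ^ n ≤
      A * ((t : ℝ) + 1) ^ C * ∑ n ∈ Finset.range (N + 1), ((hpWalks 0 n).card : ℝ) * criticalFugacity ^ n

/-- **`SpanRenewalFloor`** (the milestone, vertex form — verbatim the conclusion of the landed
`SubcriticalRenewalFloor.spanRenewalFloor_vertex_of_word`): the `x_c`-mass of bridges of span exactly `L` is
`≥ c L^{−C}` (some partial sum), for every `L ≥ 1`. -/
def SpanRenewalFloor : Prop :=
  ∃ C c : ℝ, 0 ≤ C ∧ 0 < c ∧ ∀ L : ℕ, 1 ≤ L → ∃ N : ℕ, c * (L : ℝ) ^ (-C) ≤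
    ∑ n ∈ Finset.range (N + 1), ∑ _ω ∈ (Zd.bridges 2 n).filter (fun ω => ω n 0 = (L : ℤ)), criticalFugacity ^ n

/-! ## C. The count form of S3 is an admissible replacement (registered sub-goal anchoring this file) -/

/-- **`CountProfileBound` is an admissible replacement of S3**: under `QuadrantDivergence` the fugacity-free count
form implies the partial-sum form `QuadrantProfileBound` (split the shifted partial sum at `n₀(R)`; the head
`Σ_{n<n₀} q^{(R+1)}_n x_c^n` is a constant, which the divergent corner partial sums eventually dominate; exponent
unchanged, constant `A + 1`).  So a worker who proves the count form lands it as a helper and obtains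
`stub_quadrantProfileBound` from this lemma and S2.  (Registered sub-goal `quadrantProfileBound_of_count` of
stmt-CriticalPhenomena-4730; proof verbatim from the checked skeleton.) -/
theorem quadrantProfileBound_of_count : QuadrantDivergence → CountProfileBound → QuadrantProfileBound := by
  intro hdiv hcount
  have hx0 : (0 : ℝ) ≤ criticalFugacity := criticalFugacity_pos.le
  obtain ⟨A, C, hA, hC, h⟩ := hcount
  refine ⟨A + 1, C, by linarith, hC, fun R => ?_⟩
  obtain ⟨n₀, hn₀⟩ := h R
  -- the head of the shifted series, a constant
  set H : ℝ := ∑ n ∈ Finset.range n₀, ((quadWalks (R + 1) n).card : ℝ) * criticalFugacity ^ n with hH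
  obtain ⟨N₁, hN₁⟩ := hdiv H
  refine ⟨max n₀ N₁, fun N hN => ?_⟩
  have hn₀N : n₀ ≤ N := (le_max_left _ _).trans hN
  have hN₁N : N₁ ≤ N := (le_max_right _ _).trans hN
  set f : ℕ → ℝ := fun n => ((quadWalks (R + 1) n).card : ℝ) * criticalFugacity ^ n with hf
  set g : ℕ → ℝ := fun n => ((quadWalks 0 n).card : ℝ) * criticalFugacity ^ n with hg
  have hg0 : ∀ n, 0 ≤ g n := fun n => mul_nonneg (Nat.cast_nonneg _) (pow_nonneg hx0 n)
  have hB0 : 0 ≤ A * ((R : ℝ) + 2) ^ C :=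
    mul_nonneg (by linarith) (Real.rpow_nonneg (by positivity) C)
  -- P_N ≥ P_{N₁} ≥ H
  have hPN : H ≤ ∑ n ∈ Finset.range (N + 1), g n :=
    hN₁.trans (Finset.sum_le_sum_of_subset_of_nonneg (Finset.range_mono (by omega)) fun n _ _ => hg0 n)
  -- split the shifted partial sum at n₀
  have hsplit : ∑ n ∈ Finset.range (N + 1), f n =
      H + ∑ n ∈ Finset.Ico n₀ (N + 1), f n := by
    rw [hH, Finset.range_eq_Ico, Finset.range_eq_Ico]
    exact (Finset.sum_Ico_consecutive _ (Nat.zero_le n₀) (by omega : n₀ ≤ N + 1)).symm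
  -- the tail is bounded termwise by the count form
  have htail : ∑ n ∈ Finset.Ico n₀ (N + 1), f n ≤
      A * ((R : ℝ) + 2) ^ C * ∑ n ∈ Finset.range (N + 1), g n := by
    calc ∑ n ∈ Finset.Ico n₀ (N + 1), f n
        ≤ ∑ n ∈ Finset.Ico n₀ (N + 1), A * ((R : ℝ) + 2) ^ C * g n := by
          refine Finset.sum_le_sum fun n hn => ?_
          rw [Finset.mem_Ico] at hn
          have := hn₀ n hn.1
          calc f n = ((quadWalks (R + 1) n).card : ℝ) * criticalFugacity ^ n := rfl
            _ ≤ (A * ((R : ℝ) + 2) ^ C * (quadWalks 0 n).card) * criticalFugacity ^ n :=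
                mul_le_mul_of_nonneg_right this (pow_nonneg hx0 n)
            _ = A * ((R : ℝ) + 2) ^ C * g n := by rw [hg]; ring
      _ = A * ((R : ℝ) + 2) ^ C * ∑ n ∈ Finset.Ico n₀ (N + 1), g n := by rw [Finset.mul_sum]
      _ ≤ A * ((R : ℝ) + 2) ^ C * ∑ n ∈ Finset.range (N + 1), g n := by
          refine mul_le_mul_of_nonneg_left ?_ hB0
          refine Finset.sum_le_sum_of_subset_of_nonneg ?_ fun n _ _ => hg0 n
          rw [Finset.range_eq_Ico]
          exact Finset.Ico_subset_Ico_left (Nat.zero_le _)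
  have hone : (1 : ℝ) ≤ ((R : ℝ) + 2) ^ C := Real.one_le_rpow (by linarith [(Nat.cast_nonneg R : (0 : ℝ) ≤ R)]) hC
  calc ∑ n ∈ Finset.range (N + 1), f n = H + ∑ n ∈ Finset.Ico n₀ (N + 1), f n := hsplit
    _ ≤ ∑ n ∈ Finset.range (N + 1), g n + A * ((R : ℝ) + 2) ^ C * ∑ n ∈ Finset.range (N + 1), g n :=
        add_le_add hPN htail
    _ ≤ (A + 1) * ((R : ℝ) + 2) ^ C * ∑ n ∈ Finset.range (N + 1), g n := by
        have hG : 0 ≤ ∑ n ∈ Finset.range (N + 1), g n := Finset.sum_nonneg fun n _ => hg0 n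
        nlinarith [mul_le_mul_of_nonneg_right hone hG]

end Summit.CriticalPhenomena.SAWScalingLimit.Theorems.TubeLowerBound.ProfilePotential

end
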